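import Mathlib
import Summits.ValiantsHypothesis.ValiantsHypothesis.Theorems.BarrierLeverDefinableEquationsBoolSumFourier
import Summits.ValiantsHypothesis.ValiantsHypothesis.Theorems.BarrierLeverDefinableEquationsSuccinctContraction
import Literature.Barriers.ValiantsHypothesis.FSV18UniversalConstructions

/-!
# Crux `BarrierLever.DefinableEquations` (stmt-8745) / item `SingleSizeEquations` (stmt-8749) —
# COEFFICIENT EXTRACTION: the coefficient function of a Boolean sum is the Boolean-cube marginal
# of a small polynomial ON BITS ONLY (converse of Valiant's criterion at scale `N`; val-np-p5 g7)

Converse of `…DefinableEquationsCoefficientFunction.lean`.  For a finite variable type `ι`, a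
Boolean-sum datum `H ∈ ℂ[ι ⊕ Fin q]` with `deg (boolSum H) ≤ D`, there is an `X`-FREE polynomial
`Q₀` on the bits `(ι × Fin (D+1)) ⊕ Fin (q + |ι|(D+1))` (one-hot exponent block, the old Boolean
block, and `|ι|(D+1)` Fourier bits) with

  `coeff_m (boolSum H) = ∑_w Q₀(oneHot m, w)`  for every exponent function `m : ι → Fin (D+1)`,

equivalently `∑_m (∑_w Q₀(oneHot m, w)) · X^m = boolSum H`
(`CoefficientExtraction.exists_coeffPoly`), with `L(Q₀) ≤ L(H) + 8 (|ι|+1) (D+2)²` and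
`deg Q₀ ≤ deg H · (D+1) + |ι| (D+2)`.

Witness (multivariate discrete Fourier inversion over `(ℤ/2^{D+1})^ι`, ONE copy of `H`):
`Q₀ = 2^{-(D+1)|ι|} · (∏_e ∑_j T_{e,j} tw_e(ζ^{-j})) · H(X_e := tw_e(ζ), e')`, where
`ζ = exp(2πi/2^{D+1})` (`BoolSumComponents.zeta`) and `tw_e(z) = ∏_l (1 + V_{e,l}(z^{2^l} - 1))` is
the twist in the Fourier bits of coordinate `e` (value `z^{k(v_e)}` at a Boolean point,
`BoolSumComponents.bitPow`); summing over the Fourier bits gives `∏_e 2^{D+1} [m'_e = m_e]`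
against every monomial `X^{m'}` of `boolSum H` (character orthogonality
`BoolSumComponents.sum_bitPow_freq`, exponents `≤ D < 2^{D+1}`).

So at scale `N`: the coefficient function of every level-`a` Boolean-sum equation IS a
poly(`N`)-explicit Boolean-cube marginal — with `…CoefficientFunction.lean` this makes the crux
EQUIVALENT to the existence of such explicit coefficient functions
(`…CoefficientFunctionCrux.lean`).
Route-independent; no definitions, no named facts.  Refs: P. Bürgisser, *Completeness and
Reduction in Algebraic Complexity Theory* (2000), Prop. 2.20 (criterion) and Thm. 2.13/§2.3 (the
converse direction "coefficients of `VNP` families"); L. G. Valiant, *Completeness classes in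
algebra*, STOC 1979.
-/

set_option linter.dupNamespace false

noncomputable section

namespace Summit.ValiantsHypothesis.ValiantsHypothesis.Theorems.BarrierLeverDefinableEquations

open MvPolynomial Literature.Computability.AlgebraicComplexity
open Literature.Barriers.ValiantsHypothesis
open Summit.ValiantsHypothesis.ValiantsHypothesis.Theorems.BarrierLever.BoolSumComponents
open scoped BigOperators

namespace CoefficientExtraction

/-! ### Small evaluation lemmas -/

/-- The twist `∏_l (1 + V_l (z^{2^l} - 1))` evaluates at a `0/1` point to `bitPow`. [folklore] -/
theorem eval_twist {γ : Type*} {L : ℕ} (B : γ → Bool) (v : Fin L → γ) (z : ℂ) :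
    eval (fun x => if B x then (1 : ℂ) else 0)
      (∏ l : Fin L, (1 + X (v l) * C (z ^ 2 ^ (l : ℕ) - 1)) : MvPolynomial γ ℂ) =
      bitPow (fun l => B (v l)) z := by
  unfold bitPow
  rw [map_prod]
  refine Finset.prod_congr rfl fun l _ => ?_
  rw [map_add, map_one, map_mul, eval_X, eval_C]
  split_ifs <;> ring

/-- A product of scaled indicators: `∏_e (if p e then a else 0) = if (∀ e, p e) then a^|ι| else 0`.
[folklore] -/
theorem prod_ite_const_zero {ι : Type*} [Fintype ι] (p : ι → Prop) [DecidablePred p] (a : ℂ) :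
    (∏ e : ι, if p e then a else 0) = if ∀ e, p e then a ^ Fintype.card ι else 0 := by
  split_ifs with h
  · rw [Finset.prod_congr rfl fun e _ => if_pos (h e), Finset.prod_const, Finset.card_univ]
  · push Not at h
    obtain ⟨e, he⟩ := h
    exact Finset.prod_eq_zero (Finset.mem_univ e) (if_neg he)

/-! ### The extraction identity -/

/-- Individual exponents of a monomial in the support are bounded by the total degree.
[folklore] -/
theorem apply_le_of_mem_support {ι : Type*} {E : MvPolynomial ι ℂ} {D : ℕ}
    (hD : E.totalDegree ≤ D) {m' : ι →₀ ℕ} (hm' : m' ∈ E.support) (e : ι) : m' e ≤ D :=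
  ((Finsupp.le_degree e m').trans (le_totalDegree hm')).trans hD

variable {ι : Type*} [Fintype ι] [DecidableEq ι] {q : ℕ}

/-- **Character orthogonality on `(ℤ/2^{D+1})^ι`**: for exponent vectors `m, m'` with entries
`≤ D`, `∑_{v} ∏_e ζ^{k(v_e)(m'_e - m_e)} = 2^{(D+1)|ι|} [m' = m]`. [folklore] -/
theorem sum_prod_bitPow_eq (D : ℕ) (m : ι → Fin (D + 1)) (m' : ι →₀ ℕ) (hm' : ∀ e, m' e ≤ D) :
    ∑ v : ι × Fin (D + 1) → Bool, ∏ e : ι,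
        bitPow (fun l => v (e, l)) ((zeta (D + 1))⁻¹ ^ (m e : ℕ) * zeta (D + 1) ^ m' e) =
      if m' = Finsupp.equivFunOnFinite.symm (fun e => (m e : ℕ)) then
        ((2 : ℂ) ^ (D + 1)) ^ Fintype.card ι else 0 := by
  classical
  have hlt : ∀ k : ℕ, k ≤ D → k < 2 ^ (D + 1) := fun k hk =>
    lt_of_le_of_lt hk ((Nat.lt_succ_self D).trans (Nat.lt_two_pow_self))
  -- the sum over `v` factorises over the coordinates `e`
  have hfac : ∑ v : ι × Fin (D + 1) → Bool, ∏ e : ι,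
      bitPow (fun l => v (e, l)) ((zeta (D + 1))⁻¹ ^ (m e : ℕ) * zeta (D + 1) ^ m' e) =
      ∏ e : ι, ∑ g : Fin (D + 1) → Bool,
        bitPow g ((zeta (D + 1))⁻¹ ^ (m e : ℕ) * zeta (D + 1) ^ m' e) := by
    rw [Fintype.prod_sum]
    exact Fintype.sum_equiv (Equiv.curry ι (Fin (D + 1)) Bool) _ _ fun v => rfl
  rw [hfac, Finset.prod_congr rfl fun e _ =>
    sum_bitPow_freq (D + 1) (m e : ℕ) (hlt _ (hm' e)) (hlt _ (Nat.lt_succ_iff.mp (m e).2)),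
    prod_ite_const_zero]
  refine if_congr ⟨fun h => ?_, fun h e => ?_⟩ rfl rfl
  · ext e; simp [h e]
  · rw [h]; simp

/-- **Coefficient extraction (the converse of Valiant's criterion at scale `N`).**  For
`H ∈ ℂ[ι ⊕ Fin q]` with `deg (boolSum H) ≤ D` there is an `X`-free `Q₀` on the bits
`(ι × Fin (D+1)) ⊕ Fin (q + |ι|(D+1))` whose Boolean-cube marginals are the coefficients of
`boolSum H`: `∑_m (∑_w Q₀(oneHot m, w)) · ∏_e X_e^{m e} = boolSum H`, with
`L(Q₀) ≤ L(H) + 8 (|ι|+1)(D+2)²` and `deg Q₀ ≤ deg H · (D+1) + |ι|(D+2)`.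
[cite: Burgisser2000, Prop. 2.20] -/
theorem exists_coeffPoly (D : ℕ) (H : MvPolynomial (ι ⊕ Fin q) ℂ)
    (hD : (boolSum H).totalDegree ≤ D) :
    ∃ Q₀ : MvPolynomial ((ι × Fin (D + 1)) ⊕ Fin (q + Fintype.card ι * (D + 1))) ℂ,
      (∑ m : ι → Fin (D + 1),
          C (∑ w : Fin (q + Fintype.card ι * (D + 1)) → Bool,
              eval (fun x => if Sum.elim (fun p : ι × Fin (D + 1) => decide (m p.1 = p.2)) w x
                then (1 : ℂ) else 0) Q₀) *
            ∏ e : ι, (X e : MvPolynomial ι ℂ) ^ (m e : ℕ)) = boolSum H ∧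
      complexity Q₀ ≤ complexity H + 8 * (Fintype.card ι + 1) * (D + 2) ^ 2 ∧
      Q₀.totalDegree ≤ H.totalDegree * (D + 1) + Fintype.card ι * (D + 2) := by
  classical
  -- variable type of the core: exponent bits ⊕ (old Boolean block ⊕ Fourier bits);
  -- the twist of coordinate `e` at base `z` lives in the Fourier bits of `e`
  let tw : ℂ → ι → MvPolynomial ((ι × Fin (D + 1)) ⊕ (Fin q ⊕ (ι × Fin (D + 1)))) ℂ :=
    fun z e => ∏ l : Fin (D + 1), (1 + X (Sum.inr (Sum.inr (e, l))) * C (z ^ 2 ^ (l : ℕ) - 1))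
  let θ : ι ⊕ Fin q → MvPolynomial ((ι × Fin (D + 1)) ⊕ (Fin q ⊕ (ι × Fin (D + 1)))) ℂ :=
    Sum.elim (fun e => tw (zeta (D + 1)) e) (fun j => X (Sum.inr (Sum.inl j)))
  let TW : MvPolynomial ((ι × Fin (D + 1)) ⊕ (Fin q ⊕ (ι × Fin (D + 1)))) ℂ :=
    ∏ e : ι, ∑ j : Fin (D + 1), X (Sum.inl (e, j)) * tw ((zeta (D + 1))⁻¹ ^ (j : ℕ)) e
  let core : MvPolynomial ((ι × Fin (D + 1)) ⊕ (Fin q ⊕ (ι × Fin (D + 1)))) ℂ :=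
    C (((((2 : ℂ) ^ (D + 1)) ^ Fintype.card ι))⁻¹) * (TW * aeval θ H)
  let ε : Fin q ⊕ (ι × Fin (D + 1)) ≃ Fin (q + Fintype.card ι * (D + 1)) :=
    (Equiv.sumCongr (Equiv.refl (Fin q))
      (((Fintype.equivFin ι).prodCongr (Equiv.refl (Fin (D + 1)))).trans finProdFinEquiv)).trans
      finSumFinEquiv
  -- costs of the twist
  have tw_c : ∀ z e, complexity (tw z e) ≤ 3 * (D + 1) := fun z e => by
    refine (complexity_finset_prod_le _ _).trans ?_
    rw [Finset.card_univ, Fintype.card_fin]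
    have h : ∀ l : Fin (D + 1), complexity (1 + X (Sum.inr (Sum.inr (e, l))) *
        C (z ^ 2 ^ (l : ℕ) - 1) :
          MvPolynomial ((ι × Fin (D + 1)) ⊕ (Fin q ⊕ (ι × Fin (D + 1)))) ℂ) ≤ 2 := fun l => by
      have h1 := complexity_add_le_holds
        (1 : MvPolynomial ((ι × Fin (D + 1)) ⊕ (Fin q ⊕ (ι × Fin (D + 1)))) ℂ)
        (X (Sum.inr (Sum.inr (e, l))) * C (z ^ 2 ^ (l : ℕ) - 1))
      have h2 := complexity_mul_le_holds
        (X (Sum.inr (Sum.inr (e, l))) :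
          MvPolynomial ((ι × Fin (D + 1)) ⊕ (Fin q ⊕ (ι × Fin (D + 1)))) ℂ)
        (C (z ^ 2 ^ (l : ℕ) - 1))
      have h3 := complexity_X_holds (k := ℂ)
        (Sum.inr (Sum.inr (e, l)) : (ι × Fin (D + 1)) ⊕ (Fin q ⊕ (ι × Fin (D + 1))))
      have h4 := complexity_C_holds (σ := (ι × Fin (D + 1)) ⊕ (Fin q ⊕ (ι × Fin (D + 1))))
        (z ^ 2 ^ (l : ℕ) - 1)
      have h5 : complexity
          (1 : MvPolynomial ((ι × Fin (D + 1)) ⊕ (Fin q ⊕ (ι × Fin (D + 1)))) ℂ) = 0 := by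
        rw [← C_1]; exact complexity_C_holds _
      omega
    calc ∑ l : Fin (D + 1), complexity (1 + X (Sum.inr (Sum.inr (e, l))) *
          C (z ^ 2 ^ (l : ℕ) - 1) :
            MvPolynomial ((ι × Fin (D + 1)) ⊕ (Fin q ⊕ (ι × Fin (D + 1)))) ℂ) + (D + 1)
        ≤ ∑ _l : Fin (D + 1), 2 + (D + 1) :=
          Nat.add_le_add_right (Finset.sum_le_sum fun l _ => h l) _
      _ = 3 * (D + 1) := by
          rw [Finset.sum_const, Finset.card_univ, Fintype.card_fin, smul_eq_mul]; ring
  have tw_d : ∀ z e, (tw z e).totalDegree ≤ D + 1 := fun z e => by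
    refine (totalDegree_finsetProd _ _).trans ?_
    calc ∑ l : Fin (D + 1), (1 + X (Sum.inr (Sum.inr (e, l))) * C (z ^ 2 ^ (l : ℕ) - 1) :
          MvPolynomial ((ι × Fin (D + 1)) ⊕ (Fin q ⊕ (ι × Fin (D + 1)))) ℂ).totalDegree
        ≤ ∑ _l : Fin (D + 1), 1 := Finset.sum_le_sum fun l _ => by
          refine (totalDegree_add _ _).trans (max_le ?_ ?_)
          · rw [totalDegree_one]; exact Nat.zero_le _
          · refine (totalDegree_mul _ _).trans ?_
            rw [totalDegree_X, totalDegree_C, add_zero]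
      _ = D + 1 := by simp
  refine ⟨rename (Sum.map id ε) core, ?_, ?_, ?_⟩
  · /- the extraction identity -/
    -- Step 1: re-index the marginal over `Fin (q + |ι|(D+1))` as `Fin q ⊕ (ι × Fin (D+1))`
    have hmarg : ∀ m : ι → Fin (D + 1),
        (∑ w : Fin (q + Fintype.card ι * (D + 1)) → Bool,
          eval (fun x => if Sum.elim (fun p : ι × Fin (D + 1) => decide (m p.1 = p.2)) w x
            then (1 : ℂ) else 0) (rename (Sum.map id ε) core)) =
        ∑ e' : Fin q → Bool, ∑ v : ι × Fin (D + 1) → Bool,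
          eval (fun x => if Sum.elim (fun p : ι × Fin (D + 1) => decide (m p.1 = p.2))
            (Sum.elim e' v) x then (1 : ℂ) else 0) core := by
      intro m
      rw [← SuccinctContraction.sum_boolAssign_sum
        (F := fun w' : Fin q ⊕ (ι × Fin (D + 1)) → Bool =>
          eval (fun x => if Sum.elim (fun p : ι × Fin (D + 1) => decide (m p.1 = p.2)) w' x
            then (1 : ℂ) else 0) core)]
      refine Fintype.sum_equiv (ε.symm.arrowCongr (Equiv.refl Bool)) _ _ fun w => ?_
      rw [eval_rename]
      have hfun : ((fun x => if Sum.elim (fun p : ι × Fin (D + 1) => decide (m p.1 = p.2)) w x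
            then (1 : ℂ) else 0) ∘ Sum.map id ε) =
          fun x => if Sum.elim (fun p : ι × Fin (D + 1) => decide (m p.1 = p.2))
            ((ε.symm.arrowCongr (Equiv.refl Bool)) w) x then (1 : ℂ) else 0 := by
        funext x
        rcases x with p | y
        · rfl
        · simp [Equiv.arrowCongr]
      rw [hfun]
    -- Step 2: evaluation of the core at the Boolean point `(oneHot m, e', v)`
    have hcore : ∀ (m : ι → Fin (D + 1)) (e' : Fin q → Bool) (v : ι × Fin (D + 1) → Bool),
        eval (fun x => if Sum.elim (fun p : ι × Fin (D + 1) => decide (m p.1 = p.2))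
            (Sum.elim e' v) x then (1 : ℂ) else 0) core =
          ((((2 : ℂ) ^ (D + 1)) ^ Fintype.card ι))⁻¹ *
            ((∏ e : ι, bitPow (fun l => v (e, l)) ((zeta (D + 1))⁻¹ ^ (m e : ℕ))) *
              eval (Sum.elim (fun e => bitPow (fun l => v (e, l)) (zeta (D + 1)))
                (fun j => if e' j then (1 : ℂ) else 0)) H) := by
      intro m e' v
      set B : (ι × Fin (D + 1)) ⊕ (Fin q ⊕ (ι × Fin (D + 1))) → Bool :=
        Sum.elim (fun p : ι × Fin (D + 1) => decide (m p.1 = p.2)) (Sum.elim e' v) with hBdef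
      have htw : ∀ z e, eval (fun x => if B x then (1 : ℂ) else 0) (tw z e) =
          bitPow (fun l => v (e, l)) z := fun z e => by
        have h := eval_twist B (fun l => Sum.inr (Sum.inr (e, l))) z
        simpa [tw, B] using h
      have hTW : eval (fun x => if B x then (1 : ℂ) else 0) TW =
          ∏ e : ι, bitPow (fun l => v (e, l)) ((zeta (D + 1))⁻¹ ^ (m e : ℕ)) := by
        simp only [TW, map_prod]
        refine Finset.prod_congr rfl fun e _ => ?_
        rw [map_sum, Finset.sum_eq_single (m e)]
        · rw [map_mul, eval_X, htw]
          simp [B]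
        · intro j _ hj
          rw [map_mul, eval_X]
          have : m e ≠ j := Ne.symm hj
          simp [B, this]
        · exact fun h => absurd (Finset.mem_univ _) h
      have hH : eval (fun x => if B x then (1 : ℂ) else 0) (aeval θ H) =
          eval (Sum.elim (fun e => bitPow (fun l => v (e, l)) (zeta (D + 1)))
            (fun j => if e' j then (1 : ℂ) else 0)) H := by
        rw [eval_aeval_eq]
        have hfun : (fun x => eval (fun y => if B y then (1 : ℂ) else 0) (θ x)) =
            Sum.elim (fun e => bitPow (fun l => v (e, l)) (zeta (D + 1)))
              (fun j => if e' j then (1 : ℂ) else 0) := by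
          funext x
          rcases x with e | j
          · simp only [θ, Sum.elim_inl]
            exact htw (zeta (D + 1)) e
          · simp [θ, B]
        rw [hfun]
      simp only [core, map_mul, eval_C]
      rw [hTW, hH]
    -- Step 3: the marginal is the coefficient
    have hcoeff : ∀ m : ι → Fin (D + 1),
        (∑ w : Fin (q + Fintype.card ι * (D + 1)) → Bool,
          eval (fun x => if Sum.elim (fun p : ι × Fin (D + 1) => decide (m p.1 = p.2)) w x
            then (1 : ℂ) else 0) (rename (Sum.map id ε) core)) =
        coeff (Finsupp.equivFunOnFinite.symm fun e => (m e : ℕ)) (boolSum H) := by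
      intro m
      rw [hmarg m]
      simp_rw [hcore m]
      rw [Finset.sum_comm]
      -- the inner sum over the old block is `eval s (boolSum H)`
      have hE : ∀ v : ι × Fin (D + 1) → Bool,
          ∑ e' : Fin q → Bool, ((((2 : ℂ) ^ (D + 1)) ^ Fintype.card ι))⁻¹ *
            ((∏ e : ι, bitPow (fun l => v (e, l)) ((zeta (D + 1))⁻¹ ^ (m e : ℕ))) *
              eval (Sum.elim (fun e => bitPow (fun l => v (e, l)) (zeta (D + 1)))
                (fun j => if e' j then (1 : ℂ) else 0)) H) =
          ((((2 : ℂ) ^ (D + 1)) ^ Fintype.card ι))⁻¹ *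
            ((∏ e : ι, bitPow (fun l => v (e, l)) ((zeta (D + 1))⁻¹ ^ (m e : ℕ))) *
              eval (fun e => bitPow (fun l => v (e, l)) (zeta (D + 1))) (boolSum H)) := fun v => by
        rw [eval_boolSum, Finset.mul_sum, Finset.mul_sum]
      simp_rw [hE]
      -- expand `boolSum H` into monomials and use orthogonality
      set E := boolSum H with hEdef
      have hexp : ∀ v : ι × Fin (D + 1) → Bool,
          (∏ e : ι, bitPow (fun l => v (e, l)) ((zeta (D + 1))⁻¹ ^ (m e : ℕ))) *
            eval (fun e => bitPow (fun l => v (e, l)) (zeta (D + 1))) E =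
          ∑ m' ∈ E.support, coeff m' E *
            ∏ e : ι, bitPow (fun l => v (e, l))
              ((zeta (D + 1))⁻¹ ^ (m e : ℕ) * zeta (D + 1) ^ m' e) := fun v => by
        conv_lhs => rw [E.as_sum, map_sum]
        rw [Finset.mul_sum]
        refine Finset.sum_congr rfl fun m' _ => ?_
        rw [eval_monomial, Finsupp.prod_fintype _ _ fun e => pow_zero _]
        rw [mul_left_comm, ← Finset.prod_mul_distrib]
        refine congrArg _ (Finset.prod_congr rfl fun e _ => ?_)
        rw [← bitPow_pow, ← bitPow_mul]
      simp_rw [hexp]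
      rw [← Finset.mul_sum, Finset.sum_comm]
      simp_rw [← Finset.mul_sum]
      rw [Finset.sum_congr rfl fun m' hm' => by
        rw [sum_prod_bitPow_eq D m m' (apply_le_of_mem_support hD hm')]]
      simp_rw [mul_ite, mul_zero]
      rw [Finset.sum_ite_eq' E.support]
      by_cases hmem : (Finsupp.equivFunOnFinite.symm fun e => (m e : ℕ)) ∈ E.support
      · rw [if_pos hmem, mul_comm (coeff _ E), ← mul_assoc,
          inv_mul_cancel₀ (pow_ne_zero _ (pow_ne_zero _ two_ne_zero)), one_mul]
      · rw [if_neg hmem, mul_zero]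
        exact (notMem_support_iff.mp hmem).symm
    -- Step 4: resum the monomials
    simp_rw [hcoeff]
    have hmono : ∀ m : ι → Fin (D + 1),
        C (coeff (Finsupp.equivFunOnFinite.symm fun e => (m e : ℕ)) (boolSum H)) *
            ∏ e : ι, (X e : MvPolynomial ι ℂ) ^ (m e : ℕ) =
          monomial (Finsupp.equivFunOnFinite.symm fun e => (m e : ℕ))
            (coeff (Finsupp.equivFunOnFinite.symm fun e => (m e : ℕ)) (boolSum H)) := by
      intro m
      rw [monomial_eq, Finsupp.prod_fintype _ _ fun e => pow_zero _]
      simp only [Finsupp.coe_equivFunOnFinite_symm]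
    simp_rw [hmono]
    have hinj : Function.Injective
        (fun m : ι → Fin (D + 1) => Finsupp.equivFunOnFinite.symm fun e => (m e : ℕ)) := by
      intro m m' h
      funext e
      have h1 := DFunLike.congr_fun h e
      simp only [Finsupp.coe_equivFunOnFinite_symm] at h1
      exact Fin.ext h1
    rw [← Finset.sum_image (f := fun m' : ι →₀ ℕ => monomial m' (coeff m' (boolSum H)))
      fun m _ m' _ h => hinj h]
    symm
    conv_lhs => rw [(boolSum H).as_sum]
    refine Finset.sum_subset (fun m' hm' => ?_) fun m' _ hm' => ?_
    · refine Finset.mem_image.mpr ⟨fun e => ⟨m' e, Nat.lt_succ_of_le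
        (apply_le_of_mem_support hD hm' e)⟩, Finset.mem_univ _, ?_⟩
      ext e
      simp
    · rw [notMem_support_iff.mp hm', monomial_zero]
  · /- the size -/
    refine (complexity_rename_le_holds' _ _).trans ?_
    have c0 : complexity core ≤ complexity (C (((((2 : ℂ) ^ (D + 1)) ^ Fintype.card ι))⁻¹) :
        MvPolynomial ((ι × Fin (D + 1)) ⊕ (Fin q ⊕ (ι × Fin (D + 1)))) ℂ) +
          complexity (TW * aeval θ H) + 1 := complexity_mul_le_holds _ _
    have c1 := complexity_mul_le_holds TW (aeval θ H)
    have cC := complexity_C_holds (σ := (ι × Fin (D + 1)) ⊕ (Fin q ⊕ (ι × Fin (D + 1))))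
      (((((2 : ℂ) ^ (D + 1)) ^ Fintype.card ι))⁻¹)
    have cH : complexity (aeval θ H) ≤ complexity H + Fintype.card ι * (3 * (D + 1)) := by
      refine (complexity_aeval_le _ _).trans (Nat.add_le_add_left ?_ _)
      rw [Fintype.sum_sum_type]
      have h0 : ∑ j : Fin q, complexity (θ (Sum.inr j)) = 0 :=
        Finset.sum_eq_zero fun j _ => by simp only [θ, Sum.elim_inr]; exact complexity_X_holds _
      rw [h0, add_zero]
      calc ∑ e : ι, complexity (θ (Sum.inl e)) ≤ ∑ _e : ι, 3 * (D + 1) :=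
            Finset.sum_le_sum fun e _ => by simp only [θ, Sum.elim_inl]; exact tw_c _ e
        _ = Fintype.card ι * (3 * (D + 1)) := by
            rw [Finset.sum_const, Finset.card_univ, smul_eq_mul]
    have cTW : complexity TW ≤
        Fintype.card ι * ((D + 1) * (3 * (D + 1) + 1) + (D + 1)) + Fintype.card ι := by
      have hrow : ∀ e : ι, complexity (∑ j : Fin (D + 1),
          X (Sum.inl (e, j)) * tw ((zeta (D + 1))⁻¹ ^ (j : ℕ)) e) ≤
            (D + 1) * (3 * (D + 1) + 1) + (D + 1) := fun e => by
        have h := complexity_sum_le_of_le (Finset.univ : Finset (Fin (D + 1)))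
          (fun j => X (Sum.inl (e, j)) * tw ((zeta (D + 1))⁻¹ ^ (j : ℕ)) e) (3 * (D + 1) + 1)
          fun j _ => by
            have h1 := complexity_mul_le_holds
              (X (Sum.inl (e, j)) :
                MvPolynomial ((ι × Fin (D + 1)) ⊕ (Fin q ⊕ (ι × Fin (D + 1)))) ℂ)
              (tw ((zeta (D + 1))⁻¹ ^ (j : ℕ)) e)
            have h2 := complexity_X_holds (k := ℂ)
              (Sum.inl (e, j) : (ι × Fin (D + 1)) ⊕ (Fin q ⊕ (ι × Fin (D + 1))))
            have h3 := tw_c ((zeta (D + 1))⁻¹ ^ (j : ℕ)) e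
            omega
        rw [Finset.card_univ, Fintype.card_fin] at h
        exact h
      have h := complexity_prod_le_of_le (Finset.univ : Finset ι) _ _ fun e _ => hrow e
      rw [Finset.card_univ] at h
      exact h
    have key : Fintype.card ι * ((D + 1) * (3 * (D + 1) + 1) + (D + 1)) + Fintype.card ι +
        Fintype.card ι * (3 * (D + 1)) + 2 ≤ 8 * (Fintype.card ι + 1) * (D + 2) ^ 2 := by
      nlinarith
    omega
  · /- the degree -/
    refine (totalDegree_rename_le _ _).trans ?_
    have d0 : core.totalDegree ≤ (C (((((2 : ℂ) ^ (D + 1)) ^ Fintype.card ι))⁻¹) :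
        MvPolynomial ((ι × Fin (D + 1)) ⊕ (Fin q ⊕ (ι × Fin (D + 1)))) ℂ).totalDegree +
          (TW * aeval θ H).totalDegree := totalDegree_mul _ _
    have d1 := totalDegree_mul TW (aeval θ H)
    have dC : (C (((((2 : ℂ) ^ (D + 1)) ^ Fintype.card ι))⁻¹) :
        MvPolynomial ((ι × Fin (D + 1)) ⊕ (Fin q ⊕ (ι × Fin (D + 1)))) ℂ).totalDegree = 0 :=
      totalDegree_C _
    have dH : (aeval θ H).totalDegree ≤ H.totalDegree * (D + 1) := by
      rw [show aeval θ H = bind₁ θ H from rfl]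
      refine FSV2018.totalDegree_bind₁_le_mul _ (D + 1) (fun x => ?_) H
      rcases x with e | j
      · simp only [θ, Sum.elim_inl]; exact tw_d _ e
      · simp only [θ, Sum.elim_inr, totalDegree_X]; omega
    have dTW : TW.totalDegree ≤ Fintype.card ι * (D + 2) := by
      have h := totalDegree_prod_le_of_le (Finset.univ : Finset ι)
        (fun e => ∑ j : Fin (D + 1), X (Sum.inl (e, j)) * tw ((zeta (D + 1))⁻¹ ^ (j : ℕ)) e)
        (D + 2) fun e _ => totalDegree_sum_le_of_le _ _ _ fun j _ =>
          (totalDegree_mul _ _).trans (by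
            have h1 := totalDegree_X_le_one (k := ℂ)
              (Sum.inl (e, j) : (ι × Fin (D + 1)) ⊕ (Fin q ⊕ (ι × Fin (D + 1))))
            have h2 := tw_d ((zeta (D + 1))⁻¹ ^ (j : ℕ)) e
            omega)
      rw [Finset.card_univ] at h
      exact h
    omega

end CoefficientExtraction

end Summit.ValiantsHypothesis.ValiantsHypothesis.Theorems.BarrierLeverDefinableEquations

end
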